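import Summits.NavierStokesRegularity.NavierStokesRegularity.Theorems.HeredityAtOneT.Negative.HeredityAtOneTFalseOfSubfloorStageAtOneT
import Summits.NavierStokesRegularity.FluidComputer.PalasekTowerFaceLayerAt

/-!
# The survivor-kill templates against the R-GENERIC FACE LAYER — `HeredityOrBreakdownGAt R k`,
# `HeredityOrBreakdownFromGAt R k₀`, `WindowCeilingGAt R k` — and the planner's tuned stubs BY NAME

Cell `ns-blowup`, seat `ns-blowup-refuter4` (g9, K202; refuter of record for route `PalasekTowerBreakdown` rev 19 and
its RE-BASE cruxes `HeredityAtOneT` = stmt-…-20304, `HeredityFromTwoT` = stmt-…-20305). Negative lemmas only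
(`Theorems/<Crux>/Negative/` lane): no definition, no Theses statement asserted, nothing about Navier–Stokes decided.

The tenure planner's BIRTH skeletons v1 cut the two heredity cruxes LOSSLESSLY into a (C)-clause and a load-bearing
clause (STATUS 2026-08-27 l.9297; faces typed R-generically by fc-prover-2, `PalasekTowerFaceLayerAt.lean`):
`HeredityAtOneT ↔ NoPrematureBreakdownGAt tuned 1 ∧ HeredityOrBreakdownGAt tuned 1` (stubs `stub_no_premature_breakdownT1`,
`stub_or_breakdownT1`) and `HeredityFromTwoT ↔ (∀ k ≥ 2, NoPrematureBreakdownGAt tuned k) ∧ HeredityOrBreakdownFromGAt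
tuned 2` (stubs `stub_no_premature_breakdownT2`, `stub_or_breakdown_fromT2`). This file records WHICH clause the two
standing survivor-kill templates bite, at every rates record `R` and every level:

* §1 the SUB-FLOOR template (`SubfloorStageGAt R k`, p525716: a pinned rigid quiet design with a registered level-`k`
  stage and a classical finite-energy competitor from the Clay datum on `[0, τ (k+1)]` that MISSES the speed floor
  `c₁ Y_{k+1}` in the ball at `τ (k+1)`) kills the LOAD-BEARING clause `HeredityOrBreakdownGAt R k` — the design
  LIVES to `τ (k+1)` by its own competitor, so the breakdown disjunct is refuted by the witness itself, and the
  extension disjunct by forced uniqueness (`Stage.velocity_eq_of_classical`) against the extension's floor; it never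
  touches the (C)-clause `NoPrematureBreakdownGAt` (whose negation IS (C), `navierStokesBreakdownR3_of_not_noPrematureBreakdownGAt`);
* §2 the SURVIVING-OVERSHOOT template (a competitor living to `τ (k+1)` that EXCEEDS the next ceiling `c₂ Y_{k+1}`
  somewhere on the growth window) kills the still weaker face `WindowCeilingGAt R k`, hence `HeredityOrBreakdownGAt R k`
  (`HeredityOrBreakdownGAt.windowCeiling`), hence `HeredityAtGAt R k` and `HeredityFromGAt R k₀`, `k₀ ≤ k` — the
  R-generic port of the wide templates of record (`PalasekTowerHeredityOrBreakdownTargets.lean`);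
* §3 the corollaries on the tuned rates by the planner's stub statements and the route's names:
  `SubfloorStageAtOneT → ¬ HeredityOrBreakdownGAt tuned 1` (= ¬ `stub_or_breakdownT1`), a sub-floor stage at any tuned
  level `k ≥ 2` refutes `HeredityOrBreakdownFromGAt tuned 2` (= ¬ `stub_or_breakdown_fromT2`), and a surviving
  overshoot at tuned level `1` / `k ≥ 2` refutes `HeredityAtOneT` / `HeredityFromTwoT`.

READING. The weak («or breakdown») form does not blunt either template: both witnesses are SURVIVING designs. What the
cut isolates is different — the (C)-content of the strong form — and the refuter's exposure analysis of the strong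
form (STATUS K198/K201) transfers to the load-bearing stub verbatim. LABEL: refuter kernel certificate (E–C typing).
WHAT THIS IS NOT: not NS — no design, stage or competitor is constructed here; no item is refuted.
References: [cite: Sohr2001, Ch. V Thm. 1.5.1] (forced Serrin–Masuda uniqueness, the only analysis used, already a
theorem of the tree); [cite: Palasek2026ElementaryModel, §4]; [cite: FeffermanClay2006, (C)].
-/

namespace Summit.NavierStokesRegularity.HeredityAtOneTSubfloor

open Set MeasureTheory
open scoped ENNReal NNReal
open Literature.Analysis.FluidPDE
open Summit.NavierStokesRegularity.FluidComputer.PalasekTowerClayBridge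
open Summit.NavierStokesRegularity.NavierStokesRegularity

/-! ## §1 The sub-floor template kills the load-bearing clause, at any rates and level -/

/-- **A sub-floor stage at level `k` refutes `HeredityOrBreakdownGAt R k`.** The design lives to `τ (k+1)` through the
sub-floor competitor itself (so the breakdown disjunct fails), and an extension `s'` would force the competitor to BE
`s'.u` on `[0, τ (k+1)]` (forced uniqueness in the classical finite-energy class), contradicting the extension's floor
at `τ (k+1)`. [cite: Sohr2001, Ch. V Thm. 1.5.1] -/
theorem not_heredityOrBreakdownGAt_of_subfloorStageGAt {R : TowerRates} {k : ℕ} (hW : SubfloorStageGAt R k) :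
    ¬ HeredityOrBreakdownGAt R k := by
  intro h
  obtain ⟨S, u, p, hP, hR, hQ, ⟨s⟩, hcl, hu0, hE, hsub⟩ := hW
  rcases h S hP hR hQ s with hdead | ⟨s', -⟩
  · exact hdead ⟨u, p, hcl, hu0, hE⟩
  · obtain ⟨x, hx, hfl⟩ := s'.floor (k + 1) le_rfl
    have h1 := hsub x hx
    rw [s'.velocity_eq_of_classical one_pos le_rfl hcl hu0 hE _ ⟨(S.τ_pos (k + 1)).le, le_rfl⟩] at h1
    exact absurd hfl (not_le.2 h1)

/-- … hence a sub-floor stage at any level `k ≥ k₀` refutes `HeredityOrBreakdownFromGAt R k₀`. [cite: Sohr2001, Ch. V Thm. 1.5.1] -/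
theorem not_heredityOrBreakdownFromGAt_of_subfloorStageGAt {R : TowerRates} {k₀ k : ℕ} (hk : k₀ ≤ k)
    (hW : SubfloorStageGAt R k) : ¬ HeredityOrBreakdownFromGAt R k₀ :=
  fun h => not_heredityOrBreakdownGAt_of_subfloorStageGAt hW (h k hk)

/-! ## §2 The surviving-overshoot template kills the window ceiling, at any rates and level -/

section Overshoot

variable {R : TowerRates} {k : ℕ} {S : Schedule R}

/-- **A surviving overshoot refutes `WindowCeilingGAt R k`**: a classical finite-energy competitor from the Clay datum
on `[0, τ (k+1)]` of a pinned rigid quiet design with a registered level-`k` stage, exceeding `c₂ Y_{k+1}` at some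
point of the growth window. (R-generic port of `not_windowCeilingAt_of_surviving_overshoot`.) [folklore] -/
theorem not_windowCeilingGAt_of_surviving_overshoot (hP : S.Pins 8 (6 / 5)) (hR : S.Rigid) (hQ : S.Quiet)
    (s : Stage 1 R S (Margins.routeG R) k)
    {v : ℝ → EuclideanSpace ℝ (Fin 3) → EuclideanSpace ℝ (Fin 3)} {q : ℝ → EuclideanSpace ℝ (Fin 3) → ℝ}
    (hcl : IsClassicalNSSolutionOn (Icc 0 (S.τ (k + 1))) 1 S.f v q) (hv0 : v 0 = S.u₀)
    (hE : ∃ C : ℝ≥0∞, C < ⊤ ∧ ∀ t ∈ Icc 0 (S.τ (k + 1)), ∫⁻ x, ‖v t x‖ₑ ^ 2 ≤ C)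
    (hover : ∃ t ∈ Icc (S.τ k) (S.τ (k + 1)), ∃ x, S.c₂ * R.Y (k + 1) < ‖v t x‖) :
    ¬ WindowCeilingGAt R k := by
  intro hW
  obtain ⟨t, ht, x, hx⟩ := hover
  exact absurd (hW S hP hR hQ s v q hcl hv0 hE t ht x) (not_le.2 hx)

/-- … hence refutes the load-bearing clause `HeredityOrBreakdownGAt R k` (`HeredityOrBreakdownGAt.windowCeiling`).
[cite: Sohr2001, Ch. V Thm. 1.5.1] -/
theorem not_heredityOrBreakdownGAt_of_surviving_overshoot (hP : S.Pins 8 (6 / 5)) (hR : S.Rigid) (hQ : S.Quiet)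
    (s : Stage 1 R S (Margins.routeG R) k)
    {v : ℝ → EuclideanSpace ℝ (Fin 3) → EuclideanSpace ℝ (Fin 3)} {q : ℝ → EuclideanSpace ℝ (Fin 3) → ℝ}
    (hcl : IsClassicalNSSolutionOn (Icc 0 (S.τ (k + 1))) 1 S.f v q) (hv0 : v 0 = S.u₀)
    (hE : ∃ C : ℝ≥0∞, C < ⊤ ∧ ∀ t ∈ Icc 0 (S.τ (k + 1)), ∫⁻ x, ‖v t x‖ₑ ^ 2 ≤ C)
    (hover : ∃ t ∈ Icc (S.τ k) (S.τ (k + 1)), ∃ x, S.c₂ * R.Y (k + 1) < ‖v t x‖) :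
    ¬ HeredityOrBreakdownGAt R k :=
  fun h => not_windowCeilingGAt_of_surviving_overshoot hP hR hQ s hcl hv0 hE hover h.windowCeiling

/-- … hence refutes the strong form `HeredityAtGAt R k`. [cite: Sohr2001, Ch. V Thm. 1.5.1] -/
theorem not_heredityAtGAt_of_surviving_overshoot (hP : S.Pins 8 (6 / 5)) (hR : S.Rigid) (hQ : S.Quiet)
    (s : Stage 1 R S (Margins.routeG R) k)
    {v : ℝ → EuclideanSpace ℝ (Fin 3) → EuclideanSpace ℝ (Fin 3)} {q : ℝ → EuclideanSpace ℝ (Fin 3) → ℝ}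
    (hcl : IsClassicalNSSolutionOn (Icc 0 (S.τ (k + 1))) 1 S.f v q) (hv0 : v 0 = S.u₀)
    (hE : ∃ C : ℝ≥0∞, C < ⊤ ∧ ∀ t ∈ Icc 0 (S.τ (k + 1)), ∫⁻ x, ‖v t x‖ₑ ^ 2 ≤ C)
    (hover : ∃ t ∈ Icc (S.τ k) (S.τ (k + 1)), ∃ x, S.c₂ * R.Y (k + 1) < ‖v t x‖) :
    ¬ HeredityAtGAt R k :=
  fun h => not_heredityOrBreakdownGAt_of_surviving_overshoot hP hR hQ s hcl hv0 hE hover h.orBreakdown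

/-- … and `HeredityFromGAt R k₀` for every `k₀ ≤ k`. [cite: Sohr2001, Ch. V Thm. 1.5.1] -/
theorem not_heredityFromGAt_of_surviving_overshoot {k₀ : ℕ} (hk : k₀ ≤ k) (hP : S.Pins 8 (6 / 5)) (hR : S.Rigid)
    (hQ : S.Quiet) (s : Stage 1 R S (Margins.routeG R) k)
    {v : ℝ → EuclideanSpace ℝ (Fin 3) → EuclideanSpace ℝ (Fin 3)} {q : ℝ → EuclideanSpace ℝ (Fin 3) → ℝ}
    (hcl : IsClassicalNSSolutionOn (Icc 0 (S.τ (k + 1))) 1 S.f v q) (hv0 : v 0 = S.u₀)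
    (hE : ∃ C : ℝ≥0∞, C < ⊤ ∧ ∀ t ∈ Icc 0 (S.τ (k + 1)), ∫⁻ x, ‖v t x‖ₑ ^ 2 ≤ C)
    (hover : ∃ t ∈ Icc (S.τ k) (S.τ (k + 1)), ∃ x, S.c₂ * R.Y (k + 1) < ‖v t x‖) :
    ¬ HeredityFromGAt R k₀ :=
  fun h => not_heredityAtGAt_of_surviving_overshoot hP hR hQ s hcl hv0 hE hover (h.heredityAt hk)

/-- … and the weak form from `k₀`, `HeredityOrBreakdownFromGAt R k₀`, for every `k₀ ≤ k`. [cite: Sohr2001, Ch. V Thm. 1.5.1] -/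
theorem not_heredityOrBreakdownFromGAt_of_surviving_overshoot {k₀ : ℕ} (hk : k₀ ≤ k) (hP : S.Pins 8 (6 / 5))
    (hR : S.Rigid) (hQ : S.Quiet) (s : Stage 1 R S (Margins.routeG R) k)
    {v : ℝ → EuclideanSpace ℝ (Fin 3) → EuclideanSpace ℝ (Fin 3)} {q : ℝ → EuclideanSpace ℝ (Fin 3) → ℝ}
    (hcl : IsClassicalNSSolutionOn (Icc 0 (S.τ (k + 1))) 1 S.f v q) (hv0 : v 0 = S.u₀)
    (hE : ∃ C : ℝ≥0∞, C < ⊤ ∧ ∀ t ∈ Icc 0 (S.τ (k + 1)), ∫⁻ x, ‖v t x‖ₑ ^ 2 ≤ C)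
    (hover : ∃ t ∈ Icc (S.τ k) (S.τ (k + 1)), ∃ x, S.c₂ * R.Y (k + 1) < ‖v t x‖) :
    ¬ HeredityOrBreakdownFromGAt R k₀ :=
  fun h => not_heredityOrBreakdownGAt_of_surviving_overshoot hP hR hQ s hcl hv0 hE hover (h k hk)

end Overshoot

/-! ## §3 On the tuned rates, by the planner's stub statements and the route's names -/

/-- **`SubfloorStageAtOneT` refutes the planner's load-bearing stub of `HeredityAtOneT`** (`stub_or_breakdownT1 :
HeredityOrBreakdownGAt tuned 1`, BIRTH-20304 v1) — the same witness class that p525716 holds the crux on; the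
(C)-stub `stub_no_premature_breakdownT1` is untouched by it. [cite: Sohr2001, Ch. V Thm. 1.5.1] -/
theorem HeredityOrBreakdownT1_false_of_SubfloorStageAtOneT (hW : SubfloorStageAtOneT) :
    ¬ HeredityOrBreakdownGAt TowerRates.tuned 1 :=
  not_heredityOrBreakdownGAt_of_subfloorStageGAt hW

/-- **A sub-floor stage at any tuned level `k ≥ 2` refutes the planner's load-bearing stub of `HeredityFromTwoT`**
(`stub_or_breakdown_fromT2 : ∀ k ≥ 2, HeredityOrBreakdownGAt tuned k`, i.e. `HeredityOrBreakdownFromGAt tuned 2`,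
BIRTH-20305 v1). [cite: Sohr2001, Ch. V Thm. 1.5.1] -/
theorem HeredityOrBreakdownFromT2_false_of_subfloorStageGAt {k : ℕ} (hk : 2 ≤ k)
    (hW : SubfloorStageGAt TowerRates.tuned k) : ¬ HeredityOrBreakdownFromGAt TowerRates.tuned 2 :=
  not_heredityOrBreakdownFromGAt_of_subfloorStageGAt hk hW

/-- **A surviving overshoot at tuned level `1` refutes the crux `HeredityAtOneT`** (route `PalasekTowerBreakdown`
rev 19, item stmt-…-20304), through the window-ceiling face. [cite: Sohr2001, Ch. V Thm. 1.5.1] -/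
theorem HeredityAtOneT_false_of_surviving_overshoot {S : Schedule TowerRates.tuned} (hP : S.Pins 8 (6 / 5))
    (hR : S.Rigid) (hQ : S.Quiet) (s : Stage 1 TowerRates.tuned S (Margins.routeG TowerRates.tuned) 1)
    {v : ℝ → EuclideanSpace ℝ (Fin 3) → EuclideanSpace ℝ (Fin 3)} {q : ℝ → EuclideanSpace ℝ (Fin 3) → ℝ}
    (hcl : IsClassicalNSSolutionOn (Icc 0 (S.τ 2)) 1 S.f v q) (hv0 : v 0 = S.u₀)
    (hE : ∃ C : ℝ≥0∞, C < ⊤ ∧ ∀ t ∈ Icc 0 (S.τ 2), ∫⁻ x, ‖v t x‖ₑ ^ 2 ≤ C)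
    (hover : ∃ t ∈ Icc (S.τ 1) (S.τ 2), ∃ x, S.c₂ * TowerRates.tuned.Y 2 < ‖v t x‖) :
    ¬ Theses.PalasekTowerBreakdown.HeredityAtOneT :=
  not_heredityAtGAt_of_surviving_overshoot hP hR hQ s hcl hv0 hE hover

/-- **A surviving overshoot at any tuned level `k ≥ 2` refutes the crux `HeredityFromTwoT`** (item stmt-…-20305).
[cite: Sohr2001, Ch. V Thm. 1.5.1] -/
theorem HeredityFromTwoT_false_of_surviving_overshoot {k : ℕ} (hk : 2 ≤ k) {S : Schedule TowerRates.tuned}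
    (hP : S.Pins 8 (6 / 5)) (hR : S.Rigid) (hQ : S.Quiet)
    (s : Stage 1 TowerRates.tuned S (Margins.routeG TowerRates.tuned) k)
    {v : ℝ → EuclideanSpace ℝ (Fin 3) → EuclideanSpace ℝ (Fin 3)} {q : ℝ → EuclideanSpace ℝ (Fin 3) → ℝ}
    (hcl : IsClassicalNSSolutionOn (Icc 0 (S.τ (k + 1))) 1 S.f v q) (hv0 : v 0 = S.u₀)
    (hE : ∃ C : ℝ≥0∞, C < ⊤ ∧ ∀ t ∈ Icc 0 (S.τ (k + 1)), ∫⁻ x, ‖v t x‖ₑ ^ 2 ≤ C)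
    (hover : ∃ t ∈ Icc (S.τ k) (S.τ (k + 1)), ∃ x, S.c₂ * TowerRates.tuned.Y (k + 1) < ‖v t x‖) :
    ¬ Theses.PalasekTowerBreakdown.HeredityFromTwoT :=
  not_heredityFromGAt_of_surviving_overshoot hk hP hR hQ s hcl hv0 hE hover

/-- … re-read through the cut: a sub-floor stage at a tuned level `k ≥ 2` kills `HeredityFromTwoT` VIA the planner's
load-bearing stub `stub_or_breakdown_fromT2` (consistently with p525716's direct `HeredityFromTwoT_false_of_subfloorStageGAt`).
[folklore] -/
theorem HeredityFromTwoT_false_of_subfloorStageGAt' {k : ℕ} (hk : 2 ≤ k) (hW : SubfloorStageGAt TowerRates.tuned k) :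
    ¬ Theses.PalasekTowerBreakdown.HeredityFromTwoT :=
  fun h => HeredityOrBreakdownFromT2_false_of_subfloorStageGAt hk hW (HeredityFromGAt.orBreakdown h)

/-- The hold of record re-read through the cut: `SubfloorStageAtOneT` kills `HeredityAtOneT` VIA the load-bearing
stub (the planner's composition `HeredityAtOneT_of` needs `stub_or_breakdownT1`, which it refutes), consistently
with p525716's direct kill `HeredityAtOneT_false_of_SubfloorStageAtOneT`. [folklore] -/
theorem HeredityAtOneT_false_of_SubfloorStageAtOneT' (hW : SubfloorStageAtOneT) :
    ¬ Theses.PalasekTowerBreakdown.HeredityAtOneT :=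
  fun h => HeredityOrBreakdownT1_false_of_SubfloorStageAtOneT hW (HeredityAtGAt.orBreakdown h)

end Summit.NavierStokesRegularity.HeredityAtOneTSubfloor
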